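import Summits.AtomisticToContinuum.FouriersLaw.Theses.EmbeddedDrudeMourre
import Summits.AtomisticToContinuum.FouriersLaw.Theorems.EmbeddedDrudeMourreGreenKuboContinuationRealVitali
import Summits.AtomisticToContinuum.FouriersLaw.Theorems.EmbeddedDrudeMourreGreenKuboContinuationCanonicalSeedOfRegularState
import Literature.MathematicalPhysics.KineticTheory.InfiniteChainSuperstableDynamics
import Literature.MathematicalPhysics.KineticTheory.InfiniteChainInvariantStates

/-!
# Line `temperature-blind-vitali-hurwitz` — skeleton for crux `EmbeddedDrudeMourre.GreenKuboContinuation`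
(item stmt-AtomisticToContinuum-12597; crux-plan of idea card
`Cruxes/GreenKuboContinuation/Ideas/temperature-blind-vitali-hurwitz.md`; triage r1-1 pass, r1-2 pass,
r1-3 fail — answered below; merged with the modulus of card `heated-measure-thermal-exponent` as all
three triagers proposed)

The crux (Disproof §1 `greenKuboContinuation_iff`, `Iff.rfl`): for `P = pinnedChain ω₂ lam β γ` (all
four `> 0`) and every `T₀ > 0`, Abelian Green–Kubo witnesses `W T` at every `T ∈ (0, T₀)` give
witnesses at every `T > 0`; `W T` = some DLR Gibbs state `μT`, some `μT`-preserving
`InfiniteChainDynamics` `D` with absolutely convergent current correlation `C_T`, some `κ > 0` with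
`T⁻² A_T(ν) → κ` as `ν ↓ 0`, `A_T(ν) := ∫₀^∞ e^{-νt} C_T(t) dt` (the ABEL FUNCTIONAL).

THE LINE. FREEZE THE FLOW, HEAT ONLY THE MEASURE. At fixed couplings the Buttà–Marchioro flow `Φ_t`
on the superstable set `𝒳₀ = bmGood P` is ONE `InfiniteChainDynamics` serving every temperature
(`𝒳₀` has full measure for every superstable state, BM 2016 (2.6), proved in tree as
`ButtaMarchioro2016_eq26_chain_holds`); only the canonical Gibbs state `μ_T` moves with `T`
(`stub_thermalFamily`). For this REGULAR THERMAL FAMILY the log-Abel functional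
`g_ν(T) := log A_T(ν)` is the transported object:
* `stub_canonicalSeed` — the crux's hypothesis is USED exactly here: an (existentially quantified)
  witness at `T` forces convergence of the CANONICAL `T⁻²A_T(ν)` to a positive limit (canonicity of
  the Abel functional: DLR uniqueness in the superstable class + uniqueness of the flow on `𝒳₀`);
  so on the corner `(0, T₀)` the functions `g_ν(·)` converge pointwise as `ν ↓ 0` (Vitali's seed);
* `stub_thermalExponent` — K1 of card heated-measure-thermal-exponent in log form: `ν`-UNIFORM
  Lipschitz bound `|∂_T log A_T(ν)| ≤ C_K` on compacts `K ⊂ (0,∞)` (the thermal exponent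
  `x = T∂_T log A_T(ν) = T⁻¹(⟨H⟩_tilt − ⟨H⟩_T)`, a static energy insertion against one response
  field; triage r1-1 (a)/(b), r1-2 sharpen);
* `stub_logGevreyTower` — the RELATIVE UCC of the card (triage r1-1 (a)): `ν`-uniform factorial
  bounds `|∂_T^k log A_T(ν)| ≤ C_K^{k+1} k!`, `k ≥ 2`, on compacts — the all-orders
  (quasi-analytic) clause that Disproof §6 / Tight35 `thermalExponent_tightness` show to be
  load-bearing for EXISTENCE; THE HARDEST STUB (crux-within-crux);
* `stub_realVitali` — pure analysis, TRUE: smooth functions on `(0,∞)` with `ν`-uniform factorial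
  bounds on all derivatives of order `≥ 1` on compacts, converging pointwise on `(0, T₀)`, converge
  at every `T > 0` (uniform holomorphic extension to a complex neighbourhood + local boundedness
  from the `k = 1` bound and ONE seed point + Vitali–Porter, in tree:
  `Literature.Analysis.Complex.exists_tendstoLocallyUniformlyOn_of_frequently_tendsto`).
Composition (`continuation_of_modulus`, sorry-free): `lim_ν g_ν(T) = L(T)` exists at every `T > 0`,
hence `A_T(ν) = e^{g_ν(T)} → e^{L(T)} ∈ (0, ∞)`: EXISTENCE, FINITENESS AND POSITIVITY of the Abel
limit at once (the log form makes the Hurwitz step of the card unnecessary — triage r1-1 (a),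
r1-2 (2), r1-3; Hurwitz is in tree anyway, `Literature/Analysis/Complex/Hurwitz.lean`), and
`(μ_T, Φ, T⁻²e^{L(T)})` is the witness. `GreenKuboContinuation_of` concludes the crux BY NAME from
the five stubs.

TRIAGE r1-3 ("costume of complex coupling by the conjugacy `abelFunctional_smul`") is answered by the
statement shapes, not by rhetoric: no stub complexifies anything or mentions a strip; the moduli are
REAL `ν`-uniform derivative bounds in the crux's own variable `T` at frozen flow (by the proved
conjugacy they may equally be read along the coupling ray — the skeleton does not care which
formula a prover uses for the Taylor coefficients), the `k = 0` finiteness assumption is gone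
(relative form), positivity needs no zero-free strip (log form), and the only complex analysis is
inside the TRUE lemma `stub_realVitali`.

Disproof.lean (cdisprove g2) used: §1 `continuesAlong_iff_exists`/`not_continuesAlong_lt_one` (chain
input indispensable — it enters through stubs 1–4; the seed is the only use of the hypothesis, as
`not_continuesAlong_iff` says it must be); §2b/§2c `laxWitness_all_temp`, `no_witness_of_junk_integral`
(the Gibbs clause and `κ > 0` are load-bearing: the witness built here is a DLR state of the
regular family and `κ = T⁻²e^{L} > 0`; positivity `A_T(ν) > 0` in `stub_thermalFamily` excludes the
Bochner-junk value `0`); §3 (γ is decoration: no stub uses `γ` beyond typing); §5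
`greenKuboContinuation_iff_unit_threshold'` (not needed: the line works at the given `T₀`); §6
`corner_vanishing_not_smooth_rigid`, `abelLimit_not_weakly_closed` and triage Tight35 (smooth /
first-order control does not transport existence ⇒ the all-orders `stub_logGevreyTower` is a
separate registered stub, not folded into K1), `no_witness_of_pseudogap` (an isolated zero of the
limit is excluded because `log A` converges). No `_false_without_` theorem and no landed
`Theorems/GreenKuboContinuation/Negative/*` lemma exists at planning time (Structure.lean is a
proposal); nothing here is an instance of a refuted statement (`ledger negatives`: FouriersLaw has
only stmt-12890 FarFieldGaussianity).

Registered stubs (5): `stub_thermalFamily`, `stub_canonicalSeed`, `stub_thermalExponent`,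
`stub_logGevreyTower`, `stub_realVitali`. Skeleton theorem: `GreenKuboContinuation_of :
EmbeddedDrudeMourre.GreenKuboContinuation` (no hypotheses; `sorry` enters only through the stubs).
No `def … : Prop` is declared here (untagged propositions under `Summit.*` are tree debt): the
sorry-free composition `continuation_of_modulus` spells the five statements out as hypotheses and
`GreenKuboContinuation_of := continuation_of_modulus stub_… …` certifies that they are the stubs'.

REV 2 (line lead prover-line-stmt-AtomisticToContinuum-12597-0, 2026-08-16, after wave 1). RESHAPE, same
composition idea (7 registered stubs = stubs_max):
* `stub_realVitali` — LANDED (p72547, `Theorems/EmbeddedDrudeMourreGreenKuboContinuationRealVitali.lean`,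
  purely real proof: Cauchy criterion + Taylor stepping with radius `1/(2C)`); the stub below is now a
  one-line wrapper around the tree theorem.
* HIDDEN LOAD MADE EXPLICIT. Wave 1 PROVED (worker file `work/stubs/stub_thermalExponent.lean`,
  `abelFunctional_canonical_of_thermalExponent`) that the rev-1 moduli stubs, being universally
  quantified over regular families with a hypothesis block POINTWISE in `T`, silently assert that ANY two
  shift-invariant superstable DLR states at `T` have the same Abel functional (interleave two families on
  `ℚ` / `ℝ ∖ ℚ`) — i.e. they carried 1-D DLR UNIQUENESS in the regular class. That printed theorem
  (Dobrushin 1974; Cassandro–Olivieri–Pellegrinotti–Presutti 1978; NOT in tree) is now its own stub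
  `stub_regularDLRUnique`, and `stub_thermalExponent` / `stub_logGevreyTower` take it as an explicit
  hypothesis (so they speak about THE canonical family).
* THE SEAM MADE EXPLICIT. Wave 1 showed the rev-1 `stub_canonicalSeed` needs the identification of an
  ARBITRARY crux witness (any DLR state, any preserving dynamics) with the canonical pair — DLR uniqueness
  among ALL states (false-prone) and "a.e. orbit stays in `bmGood` for all `t`" (truth open) — and PROVED
  the stub for REGULAR witnesses (`canonicalSeed_of_regularWitness`, worker file
  `work/stubs/stub_canonicalSeed.lean`, sorry-free). So: `stub_canonicalSeed` is re-registered in that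
  proved form (regular witness + uniqueness hypothesis), and the identification itself is the new stub
  `stub_witnessRegularisation` ("a temperature witnessed by any DLR pair is witnessed by a regular pair":
  shift-invariant superstable state, dynamics with carrier inside `bmGood`) — the honest import slot this
  line shares with heated-measure's `stub_seedTransfer`; it disappears if the corner items are ever retyped
  to deliver regular witnesses.
* `stub_thermalFamily` unchanged (wave 1: BLOCKED — no theorem in tree produces ANY `IsChainGibbsMeasure`;
  first missing fact = existence of a shift-invariant superstable DLR state of `pinnedChain` at every
  `T > 0`, Lebowitz–Presutti CMP 50 (1976) Thms 4.3/4.5 + Ruelle CMP 50 (1976); then invariance under the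
  BM flow (unprinted), clustering, positivity).
Composition `continuation_of_modulus` re-proved below with the seven statements; `GreenKuboContinuation_of`
still concludes the crux BY NAME with no hypotheses.

REV 3 (same lead, 2026-08-16, after wave 2). Wave 2: `stub_regularDLRUnique` BLOCKED (Cassandro–Olivieri–
Pellegrinotti–Presutti 1978, bib key `CassandroOlivieriPellegrinottiPresutti1978`, acquisition acq-03478; no DLR-uniqueness
machinery for unbounded spins in tree — Dobrushin-contraction route provably inapplicable to the quartic chain; a transfer-operator
proof is ≈ 2.2–3.5 kLoC); `stub_witnessRegularisation` BLOCKED = R1 ∧ R2 with R1 = "every crux witness STATE is regular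
(shift-invariant ∧ superstable)" — the irreducible import, not in print — and R2 = "a superstable measure preserved by ANY
`InfiniteChainDynamics` is carried by orbits lying in `bmGood` at ALL times" — TRUE and provable (energy-flux bound on
`W_{m,k}` along solutions + invariance + BM's (2.6) Borel–Cantelli); worker file `work/stubs/stub_witnessRegularisation.lean`
proves `stub_witnessRegularisation_of hR1 hR2` (with `exists_restrictOrbits`: restrict any dynamics to the all-time-good part of
its carrier, same flow). RESHAPE: the dynamics half of the seam is moved OUT of the import slot — `stub_witnessRegularisation`
now only asks for a witness whose STATE is regular (no carrier clause; weaker), and the seed becomes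
`stub_canonicalSeedOfRegularState` (regular-state witness with ARBITRARY carrier ⇒ canonical limit; proof = R2, to be landed as a
Literature theorem, + `exists_restrictOrbits` + the rev-2 `stub_canonicalSeed`, landed as
`Theorems/EmbeddedDrudeMourreGreenKuboContinuationCanonicalSeed.lean`). Seven registered stubs; composition re-proved.
WAVE 3 (same day): R2 LANDED (`Literature/MathematicalPhysics/KineticTheory/InfiniteChainOrbitEnergyFlux.lean` p74996 +
`…/InfiniteChainSuperstableOrbits.lean` p76594) and `stub_canonicalSeedOfRegularState` LANDED (p77045): stubs 4 and 7 are CLOSED;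
open: 1 (infrastructure, blocked: LP76 existence / BM-flow invariance / clustering / positivity), 2 (COPP 1978, XL formalisation),
3 (R1: temperedness of witness states — the seam), 5 (K1) and 6 (tower) — the open physics.
REV 4 (same lead, after reading the deep-refute seat's gen-1/gen-2 artefacts `Drefute-*.md`, `DrefuteK1Redundant*.lean`,
`Negative/RealVitali{Uniformity,Prefactor}Tightness.lean`): K1 (`stub_thermalExponent`) is REDUNDANT — deleted; the
Vitali consumer is re-registered in the `k ≥ 2` form `stub_realVitaliTwo` (proved from the landed `stub_realVitali`,
drefute's `realVitali_two_of_one`, landing as `Theorems/…RealVitaliTwo.lean`). SIX registered stubs: 1 thermalFamily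
(open, infrastructure), 2 regularDLRUnique (open, printed), 3 witnessRegularisation (open, the seam R1),
4 canonicalSeedOfRegularState (CLOSED p77045), 6 logGevreyTower (open, THE crux-within-crux), 7 realVitaliTwo (closing).
-/

noncomputable section

namespace Summit.AtomisticToContinuum.FouriersLaw.Cruxes.GreenKuboContinuation.TemperatureBlindVitaliHurwitz

open Filter Topology MeasureTheory Set
open Literature.MathematicalPhysics.KineticTheory.HeatConduction
/-! ## Registered stubs (the lemmas of the line; `sorry` only here)

Notation in the docstrings: `P := pinnedChain ω₂ lam β γ`; a REGULAR THERMAL FAMILY of `P` is a pair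
`(μ, D)` — `μ : ℝ → Measure ChainConfig`, `D : InfiniteChainDynamics P` — with `D.carrier = bmGood P`
(the Buttà–Marchioro superstable set) and, for every `T > 0`: `μ T` is a DLR Gibbs state at `T`,
shift-invariant, obeys the superstability estimate BM (2.3), is preserved by `D`, has absolutely
convergent current correlations at every time, and has a POSITIVE Abel functional
`A_T(ν) = ∫₀^∞ e^{-νt} C_{μ T}(t) dt > 0` for every `ν > 0`. The predicate is inlined verbatim in
stubs 1, 4, 6 (a Lines file is not importable, so no local abbreviation may enter a stub signature);
the REGULAR WITNESS class of stubs 3–4 is: DLR + shift-invariant + superstable state, dynamics with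
carrier ⊆ `bmGood P`, absolutely convergent correlations, `κ > 0`, the Abel limit. -/

/-- **Stub 1 — THE TEMPERATURE-BLIND FLOW AND ITS THERMAL FAMILY** (infrastructure, size L;
fact-conditional on `ButtaMarchioro2016_thm21_chain` like every ℋ₀ item of the sub-problem): for
`P = pinnedChain ω₂ lam β γ` (all `> 0`) there is a regular thermal family `(μ, D)`. Content: `D` :=
the BM flow packaged by `ButtaMarchioro2016_thm21_chain.exists_dynamics_pinnedChain` (carrier
`bmGood`, ONE dynamics for all `T`); `μ T` := the translation-invariant Gibbs state (1-D transfer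
operator / thermodynamic limit with free b.c.); superstability of Gibbs states (Ruelle 1976,
Benfatto–Marchioro–Presutti–Pulvirenti 1980 — cited by BM as [BMPP], not in tree); invariance of
`μ T` under `Φ_t` (finite-volume Liouville `measurePreserving_severedFlow_of_isChainGibbsMeasure`-type
statement + the partial-dynamics limit BM (3.3); not printed as a theorem — the known gap recorded in
the module docstring of `InfiniteChainSuperstableDynamics`); absolute convergence of `Σ_x ∫ j₀ j_x∘Φ_t`
at fixed `t` (BM Thm 2.2 light cone + exponential mixing of the 1-D Gibbs state); positivity
`A_T(ν) = ν‖(ν − L)⁻¹[j]‖² > 0` on `ℋ₀(μ T)` (skew Koopman generator; `[j] ≠ 0` since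
`C_T(0) = (T/2)(⟨V′(r₀)²⟩ + ⟨V′(r₀)V′(r₁)⟩) > 0`), equivalently Bochner for the positive-definite
`C_T` (`ZeroWavenumberSpace.sum_mul_inner_koopman_nonneg`). Why it might fail: only by a gap in the
infrastructure (time-invariance of the infinite-volume Gibbs state under the BM flow is unproved in
print); no physics risk. -/
theorem stub_thermalFamily :
    ∀ ω₂ lam β γ : ℝ, 0 < ω₂ → 0 < lam → 0 < β → 0 < γ →
      ∃ (μ : ℝ → MeasureTheory.Measure
            Literature.MathematicalPhysics.KineticTheory.HeatConduction.ChainConfig)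
        (D : Literature.MathematicalPhysics.KineticTheory.HeatConduction.InfiniteChainDynamics
          (Literature.MathematicalPhysics.KineticTheory.HeatConduction.pinnedChain ω₂ lam β γ)),
        D.carrier =
            (Literature.MathematicalPhysics.KineticTheory.HeatConduction.pinnedChain
              ω₂ lam β γ).bmGood ∧
          ∀ T : ℝ, 0 < T →
            (Literature.MathematicalPhysics.KineticTheory.HeatConduction.pinnedChain
                ω₂ lam β γ).IsChainGibbsMeasure T (μ T) ∧
            Literature.MathematicalPhysics.KineticTheory.HeatConduction.IsShiftInvariant (μ T) ∧
            (Literature.MathematicalPhysics.KineticTheory.HeatConduction.pinnedChain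
                ω₂ lam β γ).HasSuperstabilityEstimate (μ T) ∧
            D.PreservesMeasure (μ T) ∧
            (∀ t : ℝ, D.HasAbsConvergentCorrelation (μ T) t) ∧
            (∀ ν : ℝ, 0 < ν →
              0 < MeasureTheory.integral (MeasureTheory.volume.restrict (Set.Ioi (0:ℝ)))
                (fun t : ℝ => Real.exp (-(ν * t)) * D.currentCorrelation (μ T) t)) := by
  sorry

/-- **Stub 2 (NEW, rev 2) — DLR UNIQUENESS IN THE REGULAR CLASS** (size L; printed, NOT in tree): for
`P = pinnedChain ω₂ lam β γ` (all `> 0`) and every `T > 0`, any two DLR Gibbs states of `P` at `T`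
that are shift-invariant and satisfy Buttà–Marchioro's superstability estimate (2.3) coincide. Print:
1-D finite-range superstable unbounded-spin systems have a unique (tempered / translation-invariant)
DLR state — Dobrushin, Theory Probab. Appl. 18 (1974); Cassandro–Olivieri–Pellegrinotti–Presutti,
Z. Wahrsch. verw. Gebiete 41 (1978) 313–334 (existence AND uniqueness, via the strictly positive
Hilbert–Schmidt transfer kernel `e^{-U(a)/2T}e^{-V(b-a)/T}e^{-U(b)/2T}` / Ruelle's estimates). This is
the hidden load of the rev-1 moduli stubs made explicit (see module docstring, REV 2); stubs 4–6 take
it as a hypothesis. Why it might fail: only if the superstable class as typed (`HasSuperstabilityEstimate`,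
BM (2.3)) were wider than the tempered class of the printed theorems — it is not (it implies Ruelle's
support properties, BM (2.6)). -/
theorem stub_regularDLRUnique :
    ∀ ω₂ lam β γ : ℝ, 0 < ω₂ → 0 < lam → 0 < β → 0 < γ →
      ∀ T : ℝ, 0 < T →
        ∀ μ₁ μ₂ : MeasureTheory.Measure
            Literature.MathematicalPhysics.KineticTheory.HeatConduction.ChainConfig,
          (Literature.MathematicalPhysics.KineticTheory.HeatConduction.pinnedChain
                ω₂ lam β γ).IsChainGibbsMeasure T μ₁ →
          Literature.MathematicalPhysics.KineticTheory.HeatConduction.IsShiftInvariant μ₁ →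
          (Literature.MathematicalPhysics.KineticTheory.HeatConduction.pinnedChain
                ω₂ lam β γ).HasSuperstabilityEstimate μ₁ →
          (Literature.MathematicalPhysics.KineticTheory.HeatConduction.pinnedChain
                ω₂ lam β γ).IsChainGibbsMeasure T μ₂ →
          Literature.MathematicalPhysics.KineticTheory.HeatConduction.IsShiftInvariant μ₂ →
          (Literature.MathematicalPhysics.KineticTheory.HeatConduction.pinnedChain
                ω₂ lam β γ).HasSuperstabilityEstimate μ₂ → μ₁ = μ₂ := by
  sorry

/-- **Stub 3 (rev 3: STATE ONLY) — WITNESS REGULARISATION: the identification seam** (size open; shared in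
substance with heated-measure's `stub_seedTransfer`; rev 3 drops the carrier clause `D'.carrier ⊆ bmGood` from the
conclusion — that half is now PROVED inside `stub_canonicalSeedOfRegularState` via R2, see module docstring REV 3): for `P = pinnedChain ω₂ lam β γ` (all `> 0`) and
`T > 0`, if SOME Abelian Green–Kubo witness exists at `T` (verbatim the crux's clause: ANY DLR state,
ANY preserving dynamics with absolutely convergent correlations, `κ > 0` with the Abel limit), then a
witness with REGULAR STATE exists at `T`: a shift-invariant DLR state satisfying BM's superstability estimate
(the dynamics stays arbitrary), same clauses. This is the ONLY place where the crux's
hypothesis is consumed (then `stub_canonicalSeed` identifies the regular witness with the canonical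
pair). Content / why it might fail (wave-1 analysis, `work/stubs/stub_canonicalSeed.lean` docstring):
identifying an arbitrary witness needs F1_bare (DLR uniqueness among ALL states at `T` — false-prone:
non-tempered DLR states exist already for the harmonic chain) or a temperedness theorem for states
carrying a conducting preserved dynamics, and F2_bare (`∀ᵐ σ, ∀ t, D'.flow t σ ∈ bmGood` from
`PreservesMeasure` + `μ(bmGoodᶜ)=0` — only the fixed-`t` and countable-`t` versions follow; truth at
this generality open). The statement asks less than identification (only that SOME regular witness
exists whenever some witness exists) and is implied by "the canonical pair is a witness at every
witnessed `T`"; it holds trivially if the corner items are ever retyped to deliver regular witnesses.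
No cheap refutation: killing it needs a conducting exotic pair at a `T` where the canonical pair does
not conduct. -/
theorem stub_witnessRegularisation :
    ∀ ω₂ lam β γ : ℝ, 0 < ω₂ → 0 < lam → 0 < β → 0 < γ →
      ∀ T : ℝ, 0 < T →
        (∃ (μT : MeasureTheory.Measure
                Literature.MathematicalPhysics.KineticTheory.HeatConduction.ChainConfig)
            (D' : Literature.MathematicalPhysics.KineticTheory.HeatConduction.InfiniteChainDynamics
              (Literature.MathematicalPhysics.KineticTheory.HeatConduction.pinnedChain ω₂ lam β γ))
            (κ : ℝ),
            (Literature.MathematicalPhysics.KineticTheory.HeatConduction.pinnedChain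
                ω₂ lam β γ).IsChainGibbsMeasure T μT ∧ D'.PreservesMeasure μT ∧
            (∀ t : ℝ, D'.HasAbsConvergentCorrelation μT t) ∧ 0 < κ ∧
            Filter.Tendsto (fun ν : ℝ => (T ^ 2)⁻¹ *
              MeasureTheory.integral (MeasureTheory.volume.restrict (Set.Ioi (0:ℝ)))
                (fun t : ℝ => Real.exp (-(ν * t)) * D'.currentCorrelation μT t))
              (nhdsWithin (0:ℝ) (Set.Ioi 0)) (nhds κ)) →
        ∃ (μT : MeasureTheory.Measure
                Literature.MathematicalPhysics.KineticTheory.HeatConduction.ChainConfig)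
            (D' : Literature.MathematicalPhysics.KineticTheory.HeatConduction.InfiniteChainDynamics
              (Literature.MathematicalPhysics.KineticTheory.HeatConduction.pinnedChain ω₂ lam β γ))
            (κ : ℝ),
            (Literature.MathematicalPhysics.KineticTheory.HeatConduction.pinnedChain
                ω₂ lam β γ).IsChainGibbsMeasure T μT ∧
            Literature.MathematicalPhysics.KineticTheory.HeatConduction.IsShiftInvariant μT ∧
            (Literature.MathematicalPhysics.KineticTheory.HeatConduction.pinnedChain
                ω₂ lam β γ).HasSuperstabilityEstimate μT ∧
            D'.PreservesMeasure μT ∧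
            (∀ t : ℝ, D'.HasAbsConvergentCorrelation μT t) ∧ 0 < κ ∧
            Filter.Tendsto (fun ν : ℝ => (T ^ 2)⁻¹ *
              MeasureTheory.integral (MeasureTheory.volume.restrict (Set.Ioi (0:ℝ)))
                (fun t : ℝ => Real.exp (-(ν * t)) * D'.currentCorrelation μT t))
              (nhdsWithin (0:ℝ) (Set.Ioi 0)) (nhds κ) := by
  sorry

/-- **Stub 4 (rev 3) — CANONICAL SEED FOR WITNESSES WITH REGULAR STATE** (CLOSED: landed as the tree theorem
`Summit.AtomisticToContinuum.FouriersLaw.Theorems.GreenKuboContinuation.TemperatureBlindVitaliHurwitz.stub_canonicalSeedOfRegularState`,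
p77045, resting on the Literature theorems `OscillatorChain.ae_forall_flow_mem_bmGood(_pinnedChain)` = R2, p76594, and
`InfiniteChainOrbitEnergyFlux`, p74996; size L; replaces the
rev-2 `stub_canonicalSeed`, which is LANDED as the tree theorem
`Summit.AtomisticToContinuum.FouriersLaw.Theorems.GreenKuboContinuation.TemperatureBlindVitaliHurwitz.stub_canonicalSeed`
and is the last step of this stub's proof): for a regular thermal family `(μ, D)` of `P` and `T > 0`, IF DLR
states in the regular class at `T` are unique (statement of `stub_regularDLRUnique` at `T`) and a witness
`(μT, D', κ)` exists at `T` whose STATE is regular (DLR, shift-invariant, superstable — the conclusion of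
`stub_witnessRegularisation`; the dynamics `D'` is ARBITRARY), THEN the canonical functional converges to some
`κ' > 0`. Proof plan (wave-2 worker analysis): R2 — a superstable measure preserved by any `InfiniteChainDynamics`
is carried by orbits lying in `bmGood` at ALL times (`∀ᵐ σ ∂μT, ∀ t, D'.flow t σ ∈ bmGood`: the local energy
`W_{m,k}` along a solution has `|d/dt W_{m,k}| ≤ c(2k+3)(1+W_{m,k+1})²` (boundary energy flux), so
`E sup_{[0,τ]} e^{λW_{m,k}∘flow} ≤ e^{C''(2k+1)}` by invariance + Tonelli, then BM's (2.6) Chebyshev/Borel–Cantelli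
`measure_bmGrowthSet_gt_le` verbatim; to be landed as a Literature theorem next to `ButtaMarchioro2016_eq26_chain_holds`);
`exists_restrictOrbits` (restrict `D'` to `{σ ∈ carrier | ∀ t, flow t σ ∈ bmGood}`: same flow, carrier ⊆ bmGood,
still preserving `μT`, literally the same `currentCorrelation`); then the landed rev-2 `stub_canonicalSeed`. -/
theorem stub_canonicalSeedOfRegularState :
    ∀ ω₂ lam β γ : ℝ, 0 < ω₂ → 0 < lam → 0 < β → 0 < γ →
      ∀ (μ : ℝ → MeasureTheory.Measure
            Literature.MathematicalPhysics.KineticTheory.HeatConduction.ChainConfig)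
        (D : Literature.MathematicalPhysics.KineticTheory.HeatConduction.InfiniteChainDynamics
          (Literature.MathematicalPhysics.KineticTheory.HeatConduction.pinnedChain ω₂ lam β γ)),
        (D.carrier =
            (Literature.MathematicalPhysics.KineticTheory.HeatConduction.pinnedChain
              ω₂ lam β γ).bmGood ∧
          ∀ T : ℝ, 0 < T →
            (Literature.MathematicalPhysics.KineticTheory.HeatConduction.pinnedChain
                ω₂ lam β γ).IsChainGibbsMeasure T (μ T) ∧
            Literature.MathematicalPhysics.KineticTheory.HeatConduction.IsShiftInvariant (μ T) ∧
            (Literature.MathematicalPhysics.KineticTheory.HeatConduction.pinnedChain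
                ω₂ lam β γ).HasSuperstabilityEstimate (μ T) ∧
            D.PreservesMeasure (μ T) ∧
            (∀ t : ℝ, D.HasAbsConvergentCorrelation (μ T) t) ∧
            (∀ ν : ℝ, 0 < ν →
              0 < MeasureTheory.integral (MeasureTheory.volume.restrict (Set.Ioi (0:ℝ)))
                (fun t : ℝ => Real.exp (-(ν * t)) * D.currentCorrelation (μ T) t))) →
        ∀ T : ℝ, 0 < T →
          (∀ μ₁ μ₂ : MeasureTheory.Measure
              Literature.MathematicalPhysics.KineticTheory.HeatConduction.ChainConfig,
            (Literature.MathematicalPhysics.KineticTheory.HeatConduction.pinnedChain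
                ω₂ lam β γ).IsChainGibbsMeasure T μ₁ →
            Literature.MathematicalPhysics.KineticTheory.HeatConduction.IsShiftInvariant μ₁ →
            (Literature.MathematicalPhysics.KineticTheory.HeatConduction.pinnedChain
                ω₂ lam β γ).HasSuperstabilityEstimate μ₁ →
            (Literature.MathematicalPhysics.KineticTheory.HeatConduction.pinnedChain
                ω₂ lam β γ).IsChainGibbsMeasure T μ₂ →
            Literature.MathematicalPhysics.KineticTheory.HeatConduction.IsShiftInvariant μ₂ →
            (Literature.MathematicalPhysics.KineticTheory.HeatConduction.pinnedChain
                ω₂ lam β γ).HasSuperstabilityEstimate μ₂ → μ₁ = μ₂) →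
          (∃ (μT : MeasureTheory.Measure
                Literature.MathematicalPhysics.KineticTheory.HeatConduction.ChainConfig)
            (D' : Literature.MathematicalPhysics.KineticTheory.HeatConduction.InfiniteChainDynamics
              (Literature.MathematicalPhysics.KineticTheory.HeatConduction.pinnedChain ω₂ lam β γ))
            (κ : ℝ),
            (Literature.MathematicalPhysics.KineticTheory.HeatConduction.pinnedChain
                ω₂ lam β γ).IsChainGibbsMeasure T μT ∧
            Literature.MathematicalPhysics.KineticTheory.HeatConduction.IsShiftInvariant μT ∧
            (Literature.MathematicalPhysics.KineticTheory.HeatConduction.pinnedChain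
                ω₂ lam β γ).HasSuperstabilityEstimate μT ∧
            D'.PreservesMeasure μT ∧
            (∀ t : ℝ, D'.HasAbsConvergentCorrelation μT t) ∧ 0 < κ ∧
            Filter.Tendsto (fun ν : ℝ => (T ^ 2)⁻¹ *
              MeasureTheory.integral (MeasureTheory.volume.restrict (Set.Ioi (0:ℝ)))
                (fun t : ℝ => Real.exp (-(ν * t)) * D'.currentCorrelation μT t))
              (nhdsWithin (0:ℝ) (Set.Ioi 0)) (nhds κ)) →
          ∃ κ : ℝ, 0 < κ ∧
            Filter.Tendsto (fun ν : ℝ => (T ^ 2)⁻¹ *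
              MeasureTheory.integral (MeasureTheory.volume.restrict (Set.Ioi (0:ℝ)))
                (fun t : ℝ => Real.exp (-(ν * t)) * D.currentCorrelation (μ T) t))
              (nhdsWithin (0:ℝ) (Set.Ioi 0)) (nhds κ) := by
  exact Summit.AtomisticToContinuum.FouriersLaw.Theorems.GreenKuboContinuation.TemperatureBlindVitaliHurwitz.stub_canonicalSeedOfRegularState

/-- **Stub 6 (load-bearing, hardest; rev 2: + explicit uniqueness hypothesis) — THE LOG-GEVREY TOWER: `ν`-UNIFORM FACTORIAL BOUNDS ON ALL
HIGHER `T`-DERIVATIVES OF `log A_T(ν)`** (size XL, open; the RELATIVE UCC of card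
temperature-blind-vitali-hurwitz, triage r1-1 (a)). For a regular thermal family and `ν ∈ (0,1]`:
`T ↦ log A_T(ν)` is `C^∞` on `(0,∞)` (all `iteratedDeriv`s differentiable there), and on every
`[a,b] ⊂ (0,∞)` there is `C` with `|∂_T^k log A_T(ν)| ≤ C^{k+1} k!` for all `k ≥ 2`, `ν ∈ (0,1]`,
`T ∈ [a,b]` — i.e. `log A_·(ν)` is real-analytic with radius `≥ 1/C` UNIFORMLY IN `ν` (a fixed
complex neighbourhood of every compact of the temperature axis, never of `T = 0`). Mechanism: the
`k`-th derivative is a `(k+2)`-point static cumulant `κ_{k+2}(h_{y₁},…,h_{y_k}, j₀ ; R_ν)` with `k`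
energy legs and ONE dynamical leg; the static half (1-D Gibbs state = transfer operator, analytic in
`T`, exponentially clustering at every `T > 0`) is theorem-grade; the bet is that the tree-graph /
cluster bounds survive the Abel window uniformly in `ν` (toy spectral models keep a `ν`-free strip:
Lorentzian `d/(g + νβ²)`, Arrhenius `1/(1 + νe^{E/T})` poles at imaginary distance `π/E`; triage
r1-2 A2). This is the quasi-analytic clause that transports EXISTENCE (Disproof §6, Tight35:
first-order/smooth control does not). Why it might fail: the generic complex-temperature bound for an
observable of support `ℓ ∼ v/ν` gives a strip shrinking like `√ν` (triage r1-3 one-site Gaussian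
computation; card Dead lines (v)) — the stub asserts a cancellation special to `j₀R_ν`; it dies at a
dynamical transition temperature where complex singularities of `T ↦ A_T(ν)` pinch the real axis as
`ν ↓ 0` (cheapest falsifier: AAA/Padé tracking on a fine `T`-grid, card (b); kit j005437/j005961 ray
scans). In the De Roeck–Huveneers window (`β ≪ lam`, `1/lam ≪ T ≪ lam/β²`) `C` may be astronomically
large but must stay finite. -/
theorem stub_logGevreyTower :
    ∀ ω₂ lam β γ : ℝ, 0 < ω₂ → 0 < lam → 0 < β → 0 < γ →
      ∀ (μ : ℝ → MeasureTheory.Measure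
            Literature.MathematicalPhysics.KineticTheory.HeatConduction.ChainConfig)
        (D : Literature.MathematicalPhysics.KineticTheory.HeatConduction.InfiniteChainDynamics
          (Literature.MathematicalPhysics.KineticTheory.HeatConduction.pinnedChain ω₂ lam β γ)),
        (D.carrier =
            (Literature.MathematicalPhysics.KineticTheory.HeatConduction.pinnedChain
              ω₂ lam β γ).bmGood ∧
          ∀ T : ℝ, 0 < T →
            (Literature.MathematicalPhysics.KineticTheory.HeatConduction.pinnedChain
                ω₂ lam β γ).IsChainGibbsMeasure T (μ T) ∧
            Literature.MathematicalPhysics.KineticTheory.HeatConduction.IsShiftInvariant (μ T) ∧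
            (Literature.MathematicalPhysics.KineticTheory.HeatConduction.pinnedChain
                ω₂ lam β γ).HasSuperstabilityEstimate (μ T) ∧
            D.PreservesMeasure (μ T) ∧
            (∀ t : ℝ, D.HasAbsConvergentCorrelation (μ T) t) ∧
            (∀ ν : ℝ, 0 < ν →
              0 < MeasureTheory.integral (MeasureTheory.volume.restrict (Set.Ioi (0:ℝ)))
                (fun t : ℝ => Real.exp (-(ν * t)) * D.currentCorrelation (μ T) t))) →
        (∀ T : ℝ, 0 < T → ∀ μ₁ μ₂ : MeasureTheory.Measure
              Literature.MathematicalPhysics.KineticTheory.HeatConduction.ChainConfig,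
            (Literature.MathematicalPhysics.KineticTheory.HeatConduction.pinnedChain
                ω₂ lam β γ).IsChainGibbsMeasure T μ₁ →
            Literature.MathematicalPhysics.KineticTheory.HeatConduction.IsShiftInvariant μ₁ →
            (Literature.MathematicalPhysics.KineticTheory.HeatConduction.pinnedChain
                ω₂ lam β γ).HasSuperstabilityEstimate μ₁ →
            (Literature.MathematicalPhysics.KineticTheory.HeatConduction.pinnedChain
                ω₂ lam β γ).IsChainGibbsMeasure T μ₂ →
            Literature.MathematicalPhysics.KineticTheory.HeatConduction.IsShiftInvariant μ₂ →
            (Literature.MathematicalPhysics.KineticTheory.HeatConduction.pinnedChain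
                ω₂ lam β γ).HasSuperstabilityEstimate μ₂ → μ₁ = μ₂) →
        (∀ ν : ℝ, 0 < ν → ν ≤ 1 → ∀ k : ℕ,
          DifferentiableOn ℝ (iteratedDeriv k (fun T : ℝ => Real.log
            (MeasureTheory.integral (MeasureTheory.volume.restrict (Set.Ioi (0:ℝ)))
              (fun t : ℝ => Real.exp (-(ν * t)) * D.currentCorrelation (μ T) t)))) (Set.Ioi 0)) ∧
        ∀ a b : ℝ, 0 < a → a < b → ∃ C : ℝ, 0 < C ∧ ∀ ν : ℝ, 0 < ν → ν ≤ 1 →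
          ∀ k : ℕ, 2 ≤ k → ∀ T ∈ Set.Icc a b,
            |iteratedDeriv k (fun T : ℝ => Real.log
              (MeasureTheory.integral (MeasureTheory.volume.restrict (Set.Ioi (0:ℝ)))
                (fun t : ℝ => Real.exp (-(ν * t)) * D.currentCorrelation (μ T) t))) T| ≤
              C ^ (k + 1) * (k.factorial : ℝ) := by
  sorry

/-- **Stub 7 (rev 4) — REAL-VARIABLE VITALI PROPAGATION, `k ≥ 2` FORM** (pure analysis, TRUE; replaces the rev 1–3
`stub_realVitali` — LANDED, p72547 — by its upgrade observed and proved by the deep-refute seat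
refuter-drefute-stmt-AtomisticToContinuum-12597-g2-0 (`DrefuteK1RedundantRev3.lean`, `realVitali_two_of_one`): the
factorial bounds are needed for orders `k ≥ 2` only — two seed points + the `k = 2` bound + the mean value theorem bound
the first derivative after a rescaling `ν ↦ δν`; landing file `work/stubs/stub_realVitaliTwo.lean` →
`Theorems/EmbeddedDrudeMourreGreenKuboContinuationRealVitaliTwo.lean`). With it the composition consumes the tower
(stub 6) DIRECTLY and the first-order modulus K1 (`stub_thermalExponent`, revs 1–3) is REDUNDANT and deleted (rev 4).
Statement: `g ν` smooth on `(0,∞)` (`ν ∈ (0,1]`) with `ν`-uniform bounds `|g_ν^{(k)}| ≤ C^{k+1} k!` for all `k ≥ 2` on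
compacts, converging pointwise on `(0, T₀)` ⇒ converging at every `T > 0`. Tightness (in tree, drefute gen 1–2,
`Theorems/GreenKuboContinuation/Negative/`): without ν-UNIFORMITY of `C` (`realVitali_false_without_uniformity`, p73451),
with a polynomial prefactor `(ν⁻¹)^m` (`realVitali_false_with_polynomial_prefactor`, p74124), or without the seed
(`realVitali_false_without_seed`) the statement is FALSE. -/
theorem stub_realVitaliTwo :
    ∀ (g : ℝ → ℝ → ℝ) (T₀ : ℝ), 0 < T₀ →
      (∀ ν : ℝ, 0 < ν → ν ≤ 1 → ∀ k : ℕ, DifferentiableOn ℝ (iteratedDeriv k (g ν)) (Set.Ioi 0)) →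
      (∀ a b : ℝ, 0 < a → a < b → ∃ C : ℝ, 0 < C ∧ ∀ ν : ℝ, 0 < ν → ν ≤ 1 →
        ∀ k : ℕ, 2 ≤ k → ∀ T ∈ Set.Icc a b,
          |iteratedDeriv k (g ν) T| ≤ C ^ (k + 1) * (k.factorial : ℝ)) →
      (∀ T : ℝ, 0 < T → T < T₀ →
        ∃ L : ℝ, Filter.Tendsto (fun ν : ℝ => g ν T) (nhdsWithin (0:ℝ) (Set.Ioi 0)) (nhds L)) →
      ∀ T : ℝ, 0 < T →
        ∃ L : ℝ, Filter.Tendsto (fun ν : ℝ => g ν T) (nhdsWithin (0:ℝ) (Set.Ioi 0)) (nhds L) := by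
  sorry

/-! ## Real analysis used by the composition (proved) -/

/-- From the convergence of `T⁻² A(ν) → κ > 0` to the convergence of `log A(ν) → log (T² κ)`. -/
theorem tendsto_log_of_tendsto_inv_sq_mul {A : ℝ → ℝ} {T κ : ℝ} (hT : 0 < T) (hκ : 0 < κ)
    (h : Tendsto (fun ν : ℝ => (T ^ 2)⁻¹ * A ν) (𝓝[>] 0) (𝓝 κ)) :
    Tendsto (fun ν : ℝ => Real.log (A ν)) (𝓝[>] 0) (𝓝 (Real.log (T ^ 2 * κ))) := by
  have hT2 : T ^ 2 ≠ 0 := pow_ne_zero 2 hT.ne'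
  have hA : Tendsto A (𝓝[>] 0) (𝓝 (T ^ 2 * κ)) := by
    have := h.const_mul (T ^ 2)
    refine this.congr' (Eventually.of_forall fun ν => ?_)
    simp only [← mul_assoc, mul_inv_cancel₀ hT2, one_mul]
  exact hA.log (mul_pos (pow_pos hT 2) hκ).ne'

/-- From the convergence of `log A(ν) → L` (with `A > 0` for `ν > 0`) to `T⁻² A(ν) → T⁻² e^L`. -/
theorem tendsto_inv_sq_mul_of_tendsto_log {A : ℝ → ℝ} {T L : ℝ}
    (hpos : ∀ ν : ℝ, 0 < ν → 0 < A ν)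
    (h : Tendsto (fun ν : ℝ => Real.log (A ν)) (𝓝[>] 0) (𝓝 L)) :
    Tendsto (fun ν : ℝ => (T ^ 2)⁻¹ * A ν) (𝓝[>] 0) (𝓝 ((T ^ 2)⁻¹ * Real.exp L)) := by
  have hexp : Tendsto (fun ν : ℝ => Real.exp (Real.log (A ν))) (𝓝[>] 0) (𝓝 (Real.exp L)) :=
    (Real.continuous_exp.tendsto L).comp h
  have hA : Tendsto A (𝓝[>] 0) (𝓝 (Real.exp L)) := by
    refine hexp.congr' ?_
    filter_upwards [self_mem_nhdsWithin] with ν hν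
    exact Real.exp_log (hpos ν hν)
  exact hA.const_mul ((T ^ 2)⁻¹)

/-! ## The composition (sorry-free): the six statements ⇒ the crux, unfolded -/

/-- **`continuation_of_modulus`** (rev 4) — THE COMPOSITION with explicit hypotheses (sorry-free; axioms
propext / Classical.choice / Quot.sound): the statements of Stubs 1–4, 6, 7 (written with the namespace's
short names; the stubs spell the same terms fully qualified) imply the crux, unfolded. Per
`(ω₂, lam, β, γ, T₀)`: take the regular family `(μ, D)` (Stub 1); on the corner, a crux witness at
`T' < T₀` is traded for one with a regular STATE (Stub 3) and, DLR uniqueness in the regular class (Stub 2) identifying its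
state with `μ T'`, the canonical `log A_{T'}(ν)` converges (Stub 4 + `tendsto_log_of_tendsto_inv_sq_mul`);
the tower (Stub 6, fed the uniqueness of Stub 2) gives smoothness and the `∀ k ≥ 2` factorial bounds;
Stub 7 (`k ≥ 2` Vitali) propagates convergence of `log A_T(ν)` to every `T > 0`;
exponentiate (`tendsto_inv_sq_mul_of_tendsto_log`, using `A > 0`) and read off the witness
`(μ T, D, T⁻²e^{L})`. -/
theorem continuation_of_modulus
    (hF : ∀ ω₂ lam β γ : ℝ, 0 < ω₂ → 0 < lam → 0 < β → 0 < γ →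
      ∃ (μ : ℝ → Measure ChainConfig) (D : InfiniteChainDynamics (pinnedChain ω₂ lam β γ)),
        (D.carrier = (pinnedChain ω₂ lam β γ).bmGood ∧
          ∀ T : ℝ, 0 < T →
            (pinnedChain ω₂ lam β γ).IsChainGibbsMeasure T (μ T) ∧ IsShiftInvariant (μ T) ∧
            (pinnedChain ω₂ lam β γ).HasSuperstabilityEstimate (μ T) ∧ D.PreservesMeasure (μ T) ∧
            (∀ t : ℝ, D.HasAbsConvergentCorrelation (μ T) t) ∧
            (∀ ν : ℝ, 0 < ν →
              0 < ∫ t in Ioi (0:ℝ), Real.exp (-(ν * t)) * D.currentCorrelation (μ T) t)))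
    (hU : ∀ ω₂ lam β γ : ℝ, 0 < ω₂ → 0 < lam → 0 < β → 0 < γ → ∀ T : ℝ, 0 < T →
      ∀ μ₁ μ₂ : Measure ChainConfig,
        (pinnedChain ω₂ lam β γ).IsChainGibbsMeasure T μ₁ → IsShiftInvariant μ₁ →
        (pinnedChain ω₂ lam β γ).HasSuperstabilityEstimate μ₁ →
        (pinnedChain ω₂ lam β γ).IsChainGibbsMeasure T μ₂ → IsShiftInvariant μ₂ →
        (pinnedChain ω₂ lam β γ).HasSuperstabilityEstimate μ₂ → μ₁ = μ₂)
    (hW : ∀ ω₂ lam β γ : ℝ, 0 < ω₂ → 0 < lam → 0 < β → 0 < γ → ∀ T : ℝ, 0 < T →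
      (∃ (μT : Measure ChainConfig) (D' : InfiniteChainDynamics (pinnedChain ω₂ lam β γ)) (κ : ℝ),
            (pinnedChain ω₂ lam β γ).IsChainGibbsMeasure T μT ∧ D'.PreservesMeasure μT ∧
            (∀ t : ℝ, D'.HasAbsConvergentCorrelation μT t) ∧ 0 < κ ∧
            Tendsto (fun ν : ℝ => (T ^ 2)⁻¹ *
              ∫ t in Ioi (0:ℝ), Real.exp (-(ν * t)) * D'.currentCorrelation μT t) (𝓝[>] 0) (𝓝 κ)) →
      (∃ (μT : Measure ChainConfig) (D' : InfiniteChainDynamics (pinnedChain ω₂ lam β γ)) (κ : ℝ),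
            (pinnedChain ω₂ lam β γ).IsChainGibbsMeasure T μT ∧ IsShiftInvariant μT ∧
            (pinnedChain ω₂ lam β γ).HasSuperstabilityEstimate μT ∧ D'.PreservesMeasure μT ∧
            (∀ t : ℝ, D'.HasAbsConvergentCorrelation μT t) ∧ 0 < κ ∧
            Tendsto (fun ν : ℝ => (T ^ 2)⁻¹ *
              ∫ t in Ioi (0:ℝ), Real.exp (-(ν * t)) * D'.currentCorrelation μT t) (𝓝[>] 0) (𝓝 κ)))
    (hS : ∀ ω₂ lam β γ : ℝ, 0 < ω₂ → 0 < lam → 0 < β → 0 < γ →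
      ∀ (μ : ℝ → Measure ChainConfig) (D : InfiniteChainDynamics (pinnedChain ω₂ lam β γ)),
        (D.carrier = (pinnedChain ω₂ lam β γ).bmGood ∧
          ∀ T : ℝ, 0 < T →
            (pinnedChain ω₂ lam β γ).IsChainGibbsMeasure T (μ T) ∧ IsShiftInvariant (μ T) ∧
            (pinnedChain ω₂ lam β γ).HasSuperstabilityEstimate (μ T) ∧ D.PreservesMeasure (μ T) ∧
            (∀ t : ℝ, D.HasAbsConvergentCorrelation (μ T) t) ∧
            (∀ ν : ℝ, 0 < ν →
              0 < ∫ t in Ioi (0:ℝ), Real.exp (-(ν * t)) * D.currentCorrelation (μ T) t)) →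
        ∀ T : ℝ, 0 < T →
          (∀ μ₁ μ₂ : Measure ChainConfig,
            (pinnedChain ω₂ lam β γ).IsChainGibbsMeasure T μ₁ → IsShiftInvariant μ₁ →
            (pinnedChain ω₂ lam β γ).HasSuperstabilityEstimate μ₁ →
            (pinnedChain ω₂ lam β γ).IsChainGibbsMeasure T μ₂ → IsShiftInvariant μ₂ →
            (pinnedChain ω₂ lam β γ).HasSuperstabilityEstimate μ₂ → μ₁ = μ₂) →
          (∃ (μT : Measure ChainConfig) (D' : InfiniteChainDynamics (pinnedChain ω₂ lam β γ)) (κ : ℝ),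
            (pinnedChain ω₂ lam β γ).IsChainGibbsMeasure T μT ∧ IsShiftInvariant μT ∧
            (pinnedChain ω₂ lam β γ).HasSuperstabilityEstimate μT ∧ D'.PreservesMeasure μT ∧
            (∀ t : ℝ, D'.HasAbsConvergentCorrelation μT t) ∧ 0 < κ ∧
            Tendsto (fun ν : ℝ => (T ^ 2)⁻¹ *
              ∫ t in Ioi (0:ℝ), Real.exp (-(ν * t)) * D'.currentCorrelation μT t) (𝓝[>] 0) (𝓝 κ)) →
          ∃ κ : ℝ, 0 < κ ∧ Tendsto (fun ν : ℝ => (T ^ 2)⁻¹ *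
            ∫ t in Ioi (0:ℝ), Real.exp (-(ν * t)) * D.currentCorrelation (μ T) t) (𝓝[>] 0) (𝓝 κ))
    (hG : ∀ ω₂ lam β γ : ℝ, 0 < ω₂ → 0 < lam → 0 < β → 0 < γ →
      ∀ (μ : ℝ → Measure ChainConfig) (D : InfiniteChainDynamics (pinnedChain ω₂ lam β γ)),
        (D.carrier = (pinnedChain ω₂ lam β γ).bmGood ∧
          ∀ T : ℝ, 0 < T →
            (pinnedChain ω₂ lam β γ).IsChainGibbsMeasure T (μ T) ∧ IsShiftInvariant (μ T) ∧
            (pinnedChain ω₂ lam β γ).HasSuperstabilityEstimate (μ T) ∧ D.PreservesMeasure (μ T) ∧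
            (∀ t : ℝ, D.HasAbsConvergentCorrelation (μ T) t) ∧
            (∀ ν : ℝ, 0 < ν →
              0 < ∫ t in Ioi (0:ℝ), Real.exp (-(ν * t)) * D.currentCorrelation (μ T) t)) →
        (∀ T : ℝ, 0 < T → ∀ μ₁ μ₂ : Measure ChainConfig,
            (pinnedChain ω₂ lam β γ).IsChainGibbsMeasure T μ₁ → IsShiftInvariant μ₁ →
            (pinnedChain ω₂ lam β γ).HasSuperstabilityEstimate μ₁ →
            (pinnedChain ω₂ lam β γ).IsChainGibbsMeasure T μ₂ → IsShiftInvariant μ₂ →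
            (pinnedChain ω₂ lam β γ).HasSuperstabilityEstimate μ₂ → μ₁ = μ₂) →
        (∀ ν : ℝ, 0 < ν → ν ≤ 1 → ∀ k : ℕ, DifferentiableOn ℝ (iteratedDeriv k (fun T : ℝ => Real.log
          (∫ t in Ioi (0:ℝ), Real.exp (-(ν * t)) * D.currentCorrelation (μ T) t))) (Ioi 0)) ∧
        ∀ a b : ℝ, 0 < a → a < b → ∃ C : ℝ, 0 < C ∧ ∀ ν : ℝ, 0 < ν → ν ≤ 1 →
          ∀ k : ℕ, 2 ≤ k → ∀ T ∈ Icc a b,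
            |iteratedDeriv k (fun T : ℝ => Real.log
              (∫ t in Ioi (0:ℝ), Real.exp (-(ν * t)) * D.currentCorrelation (μ T) t)) T| ≤
              C ^ (k + 1) * (k.factorial : ℝ))
    (hV : ∀ (g : ℝ → ℝ → ℝ) (T₀ : ℝ), 0 < T₀ →
      (∀ ν : ℝ, 0 < ν → ν ≤ 1 → ∀ k : ℕ, DifferentiableOn ℝ (iteratedDeriv k (g ν)) (Ioi 0)) →
      (∀ a b : ℝ, 0 < a → a < b → ∃ C : ℝ, 0 < C ∧ ∀ ν : ℝ, 0 < ν → ν ≤ 1 →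
        ∀ k : ℕ, 2 ≤ k → ∀ T ∈ Icc a b, |iteratedDeriv k (g ν) T| ≤ C ^ (k + 1) * (k.factorial : ℝ)) →
      (∀ T : ℝ, 0 < T → T < T₀ → ∃ L : ℝ, Tendsto (fun ν : ℝ => g ν T) (𝓝[>] 0) (𝓝 L)) →
      ∀ T : ℝ, 0 < T → ∃ L : ℝ, Tendsto (fun ν : ℝ => g ν T) (𝓝[>] 0) (𝓝 L)) :
    ∀ ω₂ lam β γ : ℝ, 0 < ω₂ → 0 < lam → 0 < β → 0 < γ → ∀ T₀ : ℝ, 0 < T₀ →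
      (∀ T : ℝ, 0 < T → T < T₀ →
        ∃ (μT : MeasureTheory.Measure
              Literature.MathematicalPhysics.KineticTheory.HeatConduction.ChainConfig)
          (D : Literature.MathematicalPhysics.KineticTheory.HeatConduction.InfiniteChainDynamics
            (Literature.MathematicalPhysics.KineticTheory.HeatConduction.pinnedChain ω₂ lam β γ))
          (κ : ℝ),
          (Literature.MathematicalPhysics.KineticTheory.HeatConduction.pinnedChain
              ω₂ lam β γ).IsChainGibbsMeasure T μT ∧ D.PreservesMeasure μT ∧
          (∀ t : ℝ, D.HasAbsConvergentCorrelation μT t) ∧ 0 < κ ∧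
          Filter.Tendsto (fun ν : ℝ => (T ^ 2)⁻¹ *
            MeasureTheory.integral (MeasureTheory.volume.restrict (Set.Ioi (0:ℝ)))
              (fun t : ℝ => Real.exp (-(ν * t)) * D.currentCorrelation μT t))
            (nhdsWithin (0:ℝ) (Set.Ioi 0)) (nhds κ)) →
      ∀ T : ℝ, 0 < T →
        ∃ (μT : MeasureTheory.Measure
              Literature.MathematicalPhysics.KineticTheory.HeatConduction.ChainConfig)
          (D : Literature.MathematicalPhysics.KineticTheory.HeatConduction.InfiniteChainDynamics
            (Literature.MathematicalPhysics.KineticTheory.HeatConduction.pinnedChain ω₂ lam β γ))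
          (κ : ℝ),
          (Literature.MathematicalPhysics.KineticTheory.HeatConduction.pinnedChain
              ω₂ lam β γ).IsChainGibbsMeasure T μT ∧ D.PreservesMeasure μT ∧
          (∀ t : ℝ, D.HasAbsConvergentCorrelation μT t) ∧ 0 < κ ∧
          Filter.Tendsto (fun ν : ℝ => (T ^ 2)⁻¹ *
            MeasureTheory.integral (MeasureTheory.volume.restrict (Set.Ioi (0:ℝ)))
              (fun t : ℝ => Real.exp (-(ν * t)) * D.currentCorrelation μT t))
            (nhdsWithin (0:ℝ) (Set.Ioi 0)) (nhds κ) := by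
  intro ω₂ lam β γ hω hl hβ hγ T₀ hT₀ hcorner T hT
  -- Stub 1: the regular thermal family (one flow, moving Gibbs measure)
  obtain ⟨μ, D, hreg⟩ := hF ω₂ lam β γ hω hl hβ hγ
  have hRT := hreg.2
  have hApos : ∀ T' : ℝ, 0 < T' → ∀ ν : ℝ, 0 < ν →
      0 < ∫ t in Ioi (0:ℝ), Real.exp (-(ν * t)) * D.currentCorrelation (μ T') t :=
    fun T' hT' => (hRT T' hT').2.2.2.2.2
  -- Stub 2: DLR uniqueness in the regular class, at these parameters
  have hUq := hU ω₂ lam β γ hω hl hβ hγ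
  -- Stubs 3 + 4 on the corner: the canonical log-Abel functional converges at every T' < T₀
  have hseed : ∀ T' : ℝ, 0 < T' → T' < T₀ → ∃ L : ℝ, Tendsto (fun ν : ℝ => Real.log
      (∫ t in Ioi (0:ℝ), Real.exp (-(ν * t)) * D.currentCorrelation (μ T') t)) (𝓝[>] 0) (𝓝 L) := by
    intro T' hT' hlt
    have hWreg := hW ω₂ lam β γ hω hl hβ hγ T' hT' (hcorner T' hT' hlt)
    obtain ⟨κ', hκ', hlim⟩ := hS ω₂ lam β γ hω hl hβ hγ μ D hreg T' hT' (hUq T' hT') hWreg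
    exact ⟨_, tendsto_log_of_tendsto_inv_sq_mul hT' hκ' hlim⟩
  -- Stub 6: smoothness and the ∀ k ≥ 2 factorial bounds (the tower), ν-uniform on compacts
  obtain ⟨hsmooth, hGk⟩ := hG ω₂ lam β γ hω hl hβ hγ μ D hreg hUq
  -- Stub 7: k ≥ 2 Vitali-type propagation of the convergence of log A to every temperature
  obtain ⟨L, hL⟩ := hV (fun ν T'' => Real.log
      (∫ t in Ioi (0:ℝ), Real.exp (-(ν * t)) * D.currentCorrelation (μ T'') t))
    T₀ hT₀ hsmooth hGk hseed T hT
  -- exponentiate and read off the witness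
  refine ⟨μ T, D, (T ^ 2)⁻¹ * Real.exp L, (hRT T hT).1, (hRT T hT).2.2.2.1,
    (hRT T hT).2.2.2.2.1, mul_pos (inv_pos.mpr (pow_pos hT 2)) (Real.exp_pos L), ?_⟩
  exact tendsto_inv_sq_mul_of_tendsto_log (hApos T hT) hL

/-! ## The skeleton theorem (concludes the crux BY NAME; sorries only via the stubs) -/

/-- **`GreenKuboContinuation_of`** — the registered skeleton (rev 4): the crux
`Summit.AtomisticToContinuum.FouriersLaw.Theses.EmbeddedDrudeMourre.GreenKuboContinuation` follows
from the six declared stubs through the sorry-free composition `continuation_of_modulus`. It takes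
NO hypotheses (the only open obligations are the `stub_*` declarations, by name). Axiom closure:
`{propext, Classical.choice, Quot.sound} ∪ {sorryAx via the open stubs}` until the stubs are proved. -/
theorem GreenKuboContinuation_of :
    Summit.AtomisticToContinuum.FouriersLaw.Theses.EmbeddedDrudeMourre.GreenKuboContinuation :=
  continuation_of_modulus stub_thermalFamily stub_regularDLRUnique stub_witnessRegularisation
    stub_canonicalSeedOfRegularState stub_logGevreyTower stub_realVitaliTwo

end Summit.AtomisticToContinuum.FouriersLaw.Cruxes.GreenKuboContinuation.TemperatureBlindVitaliHurwitz

end
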